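import Literature.MathematicalPhysics.QuantumFieldTheory.Balaban1983to89.B16RLeafRecord13SepCoPH

/-!
# `Balaban1983to89.B14NodeKnitRecord13RCoPH` — YM-DAG node N11 ([Balaban1988Convergent] Thm 1 p. 262) with 𝐑 EXPLICIT AND PRINT-FAITHFUL AT NODE 00's RECORD 13 v1.7 `CoPH`
# (node00-def-T FILE 27 `Node00/Record13CoPH.lean` p537939 + FILE 28T `Node00/Record13SepCoPH.lean` p539169): [III]'s Theorem of p. 245 (`B14.ThmP245PrintedI` ∕ `…SpacesI`) and
# p. 244 assumption (`B14.RAssumedP244`) READ AT THE v1.7 OBJECTS OF RECORD (`VOfRecord₁₃CoPH`, `SLaw₁₃CoPH`∕`TLaw₁₃CoPH` — the §2 laws now over the HISTORY-INDEXED residual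
# `θ.rzAt p s` and 𝐓-weights `WtOfRecord₁₃H θ p s`), Theorem 1 relative to 𝐑, the node with 𝐑 consumed from its own antecedent, the (B)-face's first conjunct from [III]'s two
# sentences — the `CoPH` twin of this seat's `…B14NodeKnitRecord13R` ∕ `…RCoP` ∕ `…RCoPR`

statement-level bookkeeping over published theorems with citation tags; kernel-checked compositions of tree theorems;
nothing here is a claim about the Yang–Mills mass gap.

v1.7 `CoPH` PORT (seat dag-n11-e g10; director-ym LINES №183 H1ʰ ∕ №185 ∕ №186 (α) ∕ №187 on node00-def-T LOCATED-9 = FINDING №9 «the residual 𝐓-weight factor `ζ` is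
HISTORY-BLIND»; №190 PRESS WORD): this module is the v1.6 storey `…B14NodeKnitRecord13RCoPR` (p534521) under node00-def-T's token map T₇ (`keymap-CoPH.tsv`):
`θ : Stage13RParams ↦ θ : Stage13HParams` (`extends Stage13RParams`, TWO new fields `Zh : (p) → ℕ → (ℕ → Set (Site …)) → (ℕ → Set (Site …)) → TkResidualW …`, `Phih : … → (ℕ → Plaq … → ℝ)`
read at the WHOLE history by `θ.zhAt p s`, `θ.rzAt p s` — DESIGN (α)), `WtOfRecord₁₃R θ p ↦ WtOfRecord₁₃H θ p s := tkWeightsOfRecordP … (θ.zhAt p s)`, `XCoPR ↦ XCoPH`,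
SITE RULE S₇ `HasSect2FormAEZ … (θ.Rz P.K) (WtOfRecord₁₃R θ P) k ↦ HasSect2FormAEZS … k (θ.rzAt P) (WtOfRecord₁₃H θ P)`; the residual-free objects `densOfRecord₁₃ ∕ tdensOfRecord₁₃ ∕
EOfRecord₁₃ ∕ gOfRecord₁₃ ∕ settingOfRecord₁₃ ∕ UbgOfRecord₁₃CoP ∕ avOfRecord` are read at `θ.toStage13Params` (neither re-issued).  Nothing below reads `Zh` ∕ `Phih` ∕ `Zr` except
through def-T's carriers; the WITNESS faces are stated at EVERY history-indexed extension `(⟨⟨θ₀, Zr⟩, Zh, Phih⟩ : Stage13HParams F N)` of the witness of record (`Zr`, `Zh`, `Phih` free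
section variables) — def-T's `Stage13HParams.ofHistoryBlind ⟨θ₀, Zr⟩` and any node00-def-K0a pin are instances by `rfl`.  Below, «v1.5 ∕ CoP» in the inherited prose refers to the
objects' origin; every declaration is stated at the v1.7 `CoPH` names.

Cell `pub-ymgap` (HUMAN RULING D-0062, Track A), seat `pub-ymgap-dag-n11-e` (R134 fan-out row N11∕s3 «`ThmP245Printed` :375 via `rOperation` from N13's `ROpLeaf`
(pairs with n13-c)»), generation 10.  [III] = [Balaban1988Convergent], [B16] = [Balaban1989LargeFieldII].  Keys: `VOfRecord₁₃CoPH`, `SLaw₁₃CoPH`, `TLaw₁₃CoPH`,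
`rOpLeaf_VOfRecord₁₃CoPH_iff`, `Stage13HParams.toStage5₁₃CoPH`, `rOperation_upOfRecord₅C_stage13CoPH_iff`, `coreOfRecord₁₃CoPH`, `towerOfRecord₁₃CoPH`,
`datumOfRecord₁₃CoPH θ (h : Provisos₁₃CoPH)`, `thm1Printed_datumOfRecord₁₃CoPH_of_tLaw_rOpLeaf` (FILE 27), `datumOfRecord₁₃SepCoPH θ (h : Provisos₁₃SepCoPH)` (FILE 28T); the induction
and the node taken BY NAME from this seat's `…B16RLeafRecord13LiveCoPH` (`sLaw₁₃CoPH_all_of_laws`, `densitiesDescribed_at_record₁₃CoPH_of_laws`, `b14_main_at_record₁₃CoPH_of_rOpLeaf`,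
`rOpLeaf_VOfRecord₁₃CoPH_of_liveSel_of_rstep` and the CLOSED leaf at the witness of record `rOpLeaf_VOfRecord₁₃CoPH_theta13LiveOfRecord`).

WHAT THIS FILE RECORDS.  §1 the leaf at a CoPH-bound run IS `ROpLeaf (VOfRecord₁₃CoPH θ P)` IS `RAssumedP244` at the carriers of record (`Iff.rfl` ×2) and is YIELDED by N13's
node statement (`rOpLeaf₁₃CoPH_of_b16_main`); §2 the four dictionaries «[III]'s sentence at the v1.7 objects of record ↔ law form» (`thmP245_at_record₁₃CoPH_iff_laws`,
`thmP245PrintedI_…`, `thmP245SpacesI_…`, `rAssumedP244_at_record₁₃CoPH_iff_laws`); §3 THEOREM 1 relative to 𝐑 with NO start slot (`sLaw₁₃CoPH_all_of_rAssumedP244`; start =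
`Node00.sLaw₁₃CoPH_zero`), what it SAYS at the history-indexed residual ∕ ζ-weights and print's minimiser background (`hasSect2FormAEZS_all_of_rAssumedP244_coPH`), and
`densitiesDescribed` at a bound world from the junction Prop; §4 the node side: `sLaw₁₃CoPH_all_of_b14_main_of_rOpLeaf`, `sLaw₁₃CoPH_all_of_b16_main_of_slots`,
`b14_main_at_record₁₃CoPH_of_b16_main`; §5 the (B)-face's first conjunct `B16.Thm1Printed (datumOfRecord₁₃CoPH θ h).C` FROM [III]'s TWO SENTENCES IN [III]'s CURRENCY
(`thm1Printed_datumOfRecord₁₃CoPH_of_laws_rAssumedP244`, `thm1Printed_datumOfRecord₁₃CoPH_of_thmP245I_rAssumedP244`) and — the director's row literally, ON THE LIVE-SELECTOR LINE —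
★ `thm1Printed_datumOfRecord₁₃CoPH_of_thmP245I_of_liveSel` (from `Provisos₁₃CoPH`'s row `rstep`), its rev-24-keyed form ★ `thm1Printed_datumOfRecord₁₃SepCoPH_of_thmP245I_of_liveSel`
(`h : Provisos₁₃SepCoPH`), ★★ `thm1Printed_datumOfRecord₁₃CoPH_theta13LiveOfRecord_of_thmP245I` AT THE WITNESS OF RECORD — the leaf CLOSED, `hrec : Provisos₁₃CoPH` only the datum's key.
(The `IsRecordOfRecord₁₃CCoPH`-keyed (D, w)-face is `…B16RLeafRecord13LiveCoPH.densitiesDescribed_of_isRecordOfRecord₁₃CCoPH_of_rOperation`, not restated.)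

HONEST FRAMING.  Dictionary ∕ composition bookkeeping; 0 `def`; the Theorem of p. 245 (Sects. 1–3 of [III]) and, off the live line, the p. 244 assumption ([B16]
Thm 1) are DISPLAYED hypotheses; the `T`-family binder ranges over the cell's `RTOpI` carrier (dictionary-level only; the load-bearing content is the law reading);
on the live line 𝐑 of record integrates out only terms of zero fibre mass ([B16] Thm 1's 𝐑-construction NOT exercised); which history-indexed weights make (S1ᵀ)
satisfiable off the no-expansion diagonal is [III] Sect. 1 ∕ §3 ∕ Thm 2 proper, not this file; nothing of Bałaban's analysis is asserted; N11 NOT discharged; the K1-class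
item NOT closed; counts unmoved; general `N`; one finite `𝕋⁴_{L^K}` programme at fixed `ε = L^{−K}` — NOT a continuum ∕ OS ∕ mass-gap ∕ Clay statement.
-/

noncomputable section

open MeasureTheory
open scoped BigOperators Matrix.Norms.L2Operator

namespace Literature.MathematicalPhysics.QuantumFieldTheory.Balaban1983to89.B14NodeKnitRecord13RCoPH

open T4Continuum T4DatumAssembly Node00 B14.Eq218Concrete DagBinding
open B16RLeafRecord13Live B16RLeafRecord13AtLive B16RLeafRecord13LiveRstep B16RLeafRecord13LiveGenericZS B16RLeafRecord13LiveCoPH B16RLeafRecord13SepCoPH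
open B14NodeKnitTowerDatum (densitiesDescribed_iff_core)

variable (F : T4Family) (N : ℕ) [NeZero N]

/-! ## §1. The 𝐑-antecedent at Stage 13, PRINT-FAITHFUL: the leaf at the carriers of record, by name, and as [III]'s p. 244 sentence -/

section Leaf

variable (θ : Stage13HParams F N) (w : WorldP) (P : B12.RunParams)

/-- **THE 𝐑-ANTECEDENT OF N11 AT A STAGE-13-BOUND RUN IS THE LEAF AT THE CARRIERS OF RECORD** (the junction Prop with N13, BY NAME): at `w.up P = upOfRecord₅C F N
(θ.toStage5₁₃CoPH F N) P`, `(leavesP w P).rOperation ↔ ROpLeaf (VOfRecord₁₃CoPH F N θ P)` (`Iff.rfl` behind the binding equation; nothing unfolded — the law-transport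
unfolding is dag-n24-c's `rOperation_iff_laws₁₃` (at v1.2)). [cite: Balaban1988Convergent, p.244 (bookkeeping: the leaf named)] -/
theorem rOperation_iff_rOpLeaf₁₃CoPH (hup : w.up P = upOfRecord₅C F N (θ.toStage5₁₃CoPH F N) P) :
    (leavesP w P).rOperation ↔ ROpLeaf (VOfRecord₁₃CoPH F N θ P) := by
  show (w.up P).rOperation ↔ _
  rw [hup]
  exact Iff.rfl

/-- **THE LEAF AT THE STAGE-13 CARRIERS OF RECORD IS [III]'s TYPED p. 244 SENTENCE** (`B14.RAssumedP244`, verbatim there: *«we will only assume that it has some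
properties incorporated in the inductive description of the effective actions»*) for the density operation, target space and corresponding space OF RECORD along the
run `P` (`Iff.rfl`: `DagBinding.ROpLeaf` is this by definition). [cite: Balaban1988Convergent, p.244] -/
theorem rOpLeaf₁₃CoPH_iff_rAssumedP244 :
    ROpLeaf (VOfRecord₁₃CoPH F N θ P) ↔
      B14.RAssumedP244 (VOfRecord₁₃CoPH F N θ P).R (VOfRecord₁₃CoPH F N θ P).Scorr (VOfRecord₁₃CoPH F N θ P).S P.K :=
  Iff.rfl

/-- **THE PRODUCER'S SIDE OF THE JUNCTION, Stage 13** (node N13 = [Balaban1989LargeFieldII] Thm 1, `Dag.B16_main`, whose conclusion's first conjunct is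
`ℓ.rOperation`): at a Stage-13-bound run, N13's node statement with its in-edge leaves and the small-field implication YIELDS the leaf at the carriers of record
`ROpLeaf (VOfRecord₁₃CoPH F N θ P)` — the Prop the dag-n13 lineage is asked to inhabit at Stage 13, BY NAME. [cite: Balaban1989LargeFieldII, Thm 1 p.355 (bookkeeping); Balaban1988Convergent, p.244] -/
theorem rOpLeaf₁₃CoPH_of_b16_main (hup : w.up P = upOfRecord₅C F N (θ.toStage5₁₃CoPH F N) P) (hN : Dag.B16_main (leavesP w P))
    (h5 : (leavesP w P).b5) (h6 : (leavesP w P).b6) (h7 : (leavesP w P).b7) (h9 : (leavesP w P).b9) (h10 : (leavesP w P).b10)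
    (h11 : (leavesP w P).b11) (h13 : (leavesP w P).b13) (hrb : (leavesP w P).rBasicStep)
    (hsf : (leavesP w P).smallCouplings → (leavesP w P).smallFieldInductive) :
    ROpLeaf (VOfRecord₁₃CoPH F N θ P) :=
  (rOperation_iff_rOpLeaf₁₃CoPH F N θ w P hup).1 (hN h5 h6 h7 h9 h10 h11 h13 hrb hsf).1

end Leaf

/-! ## §2. [III]'s sentences READ AT THE STAGE-13 OBJECTS OF RECORD: the Theorem of p. 245 (sequence and space readings), the p. 244 assumption -/

section Sentences

variable (θ : Stage13HParams F N) (w : WorldP) (P : B12.RunParams)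

/-- **THE THEOREM OF p. 245, SEQUENCE READING, ALONG THE TRAJECTORY OF RECORD, Stage 13** ([Balaban1988Convergent] p. 245, verbatim: *«Theorem. If ρ_k satisfies the
assumptions described in detail in Sect. 2, then Tρ_k satisfies also the corresponding assumptions.»*): with `ρ_k := densOfRecord₁₃ θ P k` in the target space of
record and `𝐓ρ_k := tdensOfRecord₁₃ θ P k` tested in the corresponding space, the sentence IS `∀ k < K, SLaw₁₃CoPH θ P k → TLaw₁₃CoPH θ P k`.  Bookkeeping.
[cite: Balaban1988Convergent, Theorem p.245; (3.25) p.270] -/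
theorem thmP245_at_record₁₃CoPH_iff_laws :
    (∀ k, k < P.K → (VOfRecord₁₃CoPH F N θ P).S k (densOfRecord₁₃ F N θ.toStage13Params P k) →
        (VOfRecord₁₃CoPH F N θ P).Scorr (k + 1) (tdensOfRecord₁₃ F N θ.toStage13Params P k)) ↔
      ∀ k, k < P.K → SLaw₁₃CoPH F N θ P k → TLaw₁₃CoPH F N θ P k := by
  refine ⟨fun h k hk hS => ?_, fun h k hk hS => ?_⟩
  · have hT : tdensOfRecord₁₃ F N θ.toStage13Params P k = tdensOfRecord₁₃ F N θ.toStage13Params P k ∧ TLaw₁₃CoPH F N θ P k := h k hk ⟨rfl, hS⟩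
    exact hT.2
  · exact ⟨rfl, h k hk hS.2⟩

/-- **[III]'s OWN SLOT NAME AT THE STAGE-13 RECORD**: for ANY family `T` of renormalization transformations on the run's lattices (the cell's carrier `RTOpI` along
the averaging of record) that AGREES WITH THE TOWER ON THE TRAJECTORY (`(T k).T ρ_k = 𝐓ρ_k` of record, `k < K`), the typed Theorem of p. 245
`B14.ThmP245PrintedI T ρ S Scorr K` at `ρ := densOfRecord₁₃ θ P`, the Stage-13 spaces of record and `K := P.K` IS `∀ k < K, SLaw₁₃CoPH θ P k → TLaw₁₃CoPH θ P k`.  (The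
`RTOp`-form `B14.ThmP245Printed` is the same Prop along `RTOp.toRTOpI`, `B14.thmP245PrintedI_toRTOpI_iff`.)  Dictionary lemma; the closers below are `T`-free.
[cite: Balaban1988Convergent, Theorem p.245] -/
theorem thmP245PrintedI_at_record₁₃CoPH_iff_laws (T : (k : ℕ) → RTOpI (F.P P.K) k (SU N) (avOfRecord F N P.K k))
    (hT : ∀ k, k < P.K → (T k).T (densOfRecord₁₃ F N θ.toStage13Params P k) = tdensOfRecord₁₃ F N θ.toStage13Params P k) :
    B14.ThmP245PrintedI T (densOfRecord₁₃ F N θ.toStage13Params P) (VOfRecord₁₃CoPH F N θ P).S (VOfRecord₁₃CoPH F N θ P).Scorr P.K ↔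
      ∀ k, k < P.K → SLaw₁₃CoPH F N θ P k → TLaw₁₃CoPH F N θ P k := by
  refine ⟨fun h k hk hS => ?_, fun h k hk hS => ?_⟩
  · have hT' : (T k).T (densOfRecord₁₃ F N θ.toStage13Params P k) = tdensOfRecord₁₃ F N θ.toStage13Params P k ∧ TLaw₁₃CoPH F N θ P k := h k hk ⟨rfl, hS⟩
    exact hT'.2
  · exact ⟨hT k hk, h k hk hS.2⟩

/-- **THE SPACE READING OF THE THEOREM OF p. 245 AT THE STAGE-13 RECORD COINCIDES WITH THE SEQUENCE READING** ([Balaban1988Convergent] p. 262, second remark: *«…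
the operation 𝐑T transforms the space with the index k into the space with the index k+1. This generalization does not seem to be useful, or interesting now.»* —
typed `B14.ThmP245SpacesI`): at the carriers of record the index-`k` space IS `{ρ : ρ = ρ_k ∧ SLaw₁₃CoPH θ P k}`, so for any agreeing `T`-family the space reading IS
`∀ k < K, SLaw₁₃CoPH θ P k → TLaw₁₃CoPH θ P k`.  Dictionary lemma. [cite: Balaban1988Convergent, Theorem p.245 with remark p.262] -/
theorem thmP245SpacesI_at_record₁₃CoPH_iff_laws (T : (k : ℕ) → RTOpI (F.P P.K) k (SU N) (avOfRecord F N P.K k))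
    (hT : ∀ k, k < P.K → (T k).T (densOfRecord₁₃ F N θ.toStage13Params P k) = tdensOfRecord₁₃ F N θ.toStage13Params P k) :
    B14.ThmP245SpacesI T (VOfRecord₁₃CoPH F N θ P).S (VOfRecord₁₃CoPH F N θ P).Scorr P.K ↔
      ∀ k, k < P.K → SLaw₁₃CoPH F N θ P k → TLaw₁₃CoPH F N θ P k := by
  refine ⟨fun h => ?_, fun h k hk ρ hρ => ?_⟩
  · exact (thmP245PrintedI_at_record₁₃CoPH_iff_laws F N θ P T hT).1 (B14.thmP245PrintedI_of_spacesI h (densOfRecord₁₃ F N θ.toStage13Params P))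
  · obtain ⟨rfl, hS⟩ := hρ
    exact ⟨hT k hk, h k hk hS⟩

/-- **THE p. 244 ASSUMPTION AT THE STAGE-13 CARRIERS OF RECORD IS «𝐓-IMAGE FORM ⇒ §2 FORM ONE LEVEL UP»**: `B14.RAssumedP244` at `VOfRecord₁₃CoPH θ P` ↔
`∀ k < K, TLaw₁₃CoPH θ P k → SLaw₁₃CoPH θ P (k+1)` — node00-def-T's `rOpLeaf_VOfRecord₁₃CoPH_iff`, quoted through §1.
[cite: Balaban1988Convergent, p.244 and Thm 2 p.263 (bookkeeping: the leaf unfolded, by name)] -/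
theorem rAssumedP244_at_record₁₃CoPH_iff_laws :
    B14.RAssumedP244 (VOfRecord₁₃CoPH F N θ P).R (VOfRecord₁₃CoPH F N θ P).Scorr (VOfRecord₁₃CoPH F N θ P).S P.K ↔
      ∀ k, k < P.K → TLaw₁₃CoPH F N θ P k → SLaw₁₃CoPH F N θ P (k + 1) :=
  (rOpLeaf₁₃CoPH_iff_rAssumedP244 F N θ P).symm.trans (rOpLeaf_VOfRecord₁₃CoPH_iff F N θ P)

end Sentences

/-! ## §3. THEOREM 1 [III] AT THE STAGE-13 OBJECTS OF RECORD, RELATIVE TO 𝐑 — no world, no binding, NO START SLOT: `θ` and the run `P` only -/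

section Thm1Relative

variable (θ : Stage13HParams F N) (P : B12.RunParams)

/-- **THEOREM 1 [III] AT THE OBJECTS OF RECORD, RELATIVE TO 𝐑, THE START A THEOREM** ([Balaban1988Convergent] Thm 1 p. 262; printed proof structure = START +
THE THEOREM OF p. 245 + THE ASSUMED 𝐑 along (0.2)), re-run at the Stage-13 laws of record (base `sLaw₁₃CoPH_zero`; the induction is this seat's `sLaw₁₃CoPH_all_of_laws`).
Hypotheses, both DISPLAYED and PRINTED: `hR` — `B14.RAssumedP244` at the 𝐑-carriers of record (= `ROpLeaf (VOfRecord₁₃CoPH …)`, N13's product); `hT` — the Theorem of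
p. 245 at the objects of record.  Conclusion: EVERY `ρ_k` of record, `k ≤ K`, has the repaired §2 [III] form of record.  Count-neutral.
[cite: Balaban1988Convergent, Thm 1 p.262; Theorem p.245; p.244] -/
theorem sLaw₁₃CoPH_all_of_rAssumedP244
    (hR : B14.RAssumedP244 (VOfRecord₁₃CoPH F N θ P).R (VOfRecord₁₃CoPH F N θ P).Scorr (VOfRecord₁₃CoPH F N θ P).S P.K)
    (hT : ∀ k, k < P.K → SLaw₁₃CoPH F N θ P k → TLaw₁₃CoPH F N θ P k) :
    ∀ k, k ≤ P.K → SLaw₁₃CoPH F N θ P k :=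
  sLaw₁₃CoPH_all_of_laws F N θ P ((rAssumedP244_at_record₁₃CoPH_iff_laws F N θ P).1 hR) hT

/-- **What Theorem 1 SAYS at Stage 13, relative to 𝐑**: for every `k ≤ K` the post-𝐑 slot family of `ρ_k` of record HAS THE REPAIRED §2 [III] FORM (`HasSect2FormAEZS`)
AT THE HISTORY-INDEXED RESIDUAL `θ.rzAt P s` AND 𝐓-WEIGHTS OF THE RUN `WtOfRecord₁₃H θ P s` and the repaired backgrounds `UbgOfRecord₁₃CoP` — `Node00.sLaw₁₃CoPH_iff`.
[cite: Balaban1988Convergent, Thm 1 p.262, (2.18) p.257, (2.23)–(2.42) pp.258–261] -/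
theorem hasSect2FormAEZS_all_of_rAssumedP244_coPH
    (hR : B14.RAssumedP244 (VOfRecord₁₃CoPH F N θ P).R (VOfRecord₁₃CoPH F N θ P).Scorr (VOfRecord₁₃CoPH F N θ P).S P.K)
    (hT : ∀ k, k < P.K → SLaw₁₃CoPH F N θ P k → TLaw₁₃CoPH F N θ P k) (k : ℕ) (hk : k ≤ P.K) :
    HasSect2FormAEZS F N (FluctV N) P.K (settingOfRecord₁₃ F N θ.toStage13Params P) k (θ.rzAt P) (WtOfRecord₁₃H F N θ P) (UbgOfRecord₁₃CoP F N θ.toStage13Params P k)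
      (slotsOfRecord F N θ.ν θ.τ9 (EOfRecord₁₃ F N θ.toStage13Params) (wOfRecord₉ F N θ.toStage9Params) θ.ppSel P (gOfRecord₁₃ F N θ.toStage13Params P) k) :=
  (sLaw₁₃CoPH_iff F N θ P k).1 (sLaw₁₃CoPH_all_of_rAssumedP244 F N θ P hR hT k hk)

variable (w : WorldP) (h : θ.Provisos₁₃CoPH F N)

/-- **Theorem 1's conclusion `densitiesDescribed` AT A STAGE-13 WORLD, RELATIVE TO 𝐑** — with 𝐑 displayed as THE LEAF AT THE CARRIERS OF RECORD `ROpLeaf (VOfRecord₁₃CoPH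
F N θ.toStage13Params P)` (the Prop node N13 produces): at `w.C = (datumOfRecord₁₃CoPH F N θ h).C`, the leaf + the Theorem of p. 245 at the objects of record give
`(leavesP w P).densitiesDescribed` — no start hypothesis. [cite: Balaban1988Convergent, Thm 1 p.262; Theorem p.245; p.244] -/
theorem densitiesDescribed_at_record₁₃CoPH_of_rOpLeaf (hC : w.C = (datumOfRecord₁₃CoPH F N θ h).C) (hR : ROpLeaf (VOfRecord₁₃CoPH F N θ P))
    (hT : ∀ k, k < P.K → SLaw₁₃CoPH F N θ P k → TLaw₁₃CoPH F N θ P k) :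
    (leavesP w P).densitiesDescribed :=
  densitiesDescribed_at_record₁₃CoPH_of_laws F N θ P w h hC ((rOpLeaf_VOfRecord₁₃CoPH_iff F N θ P).1 hR) hT

end Thm1Relative

/-! ## §4. THE NODE at a Stage-13 world, A4 locators: what N11 SAYS given its antecedents (𝐑 as print assumes it), and Theorem 1 from the two nodes' products -/

section Node

variable (θ : Stage13HParams F N) (h : θ.Provisos₁₃CoPH F N) (w : WorldP) (P : B12.RunParams)

/-- **What N11 SAYS at Stage 13, the 𝐑-antecedent AS PRINT ASSUMES IT** (A4 locator, vacuity audit in kernel form): N11 at a world bound to the datum of record, GIVEN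
its in-edge leaves, the small-field implication, the located flow step, the interval hypothesis, the reading `hV` AND THE LEAF AT THE CARRIERS OF RECORD `ROpLeaf
(VOfRecord₁₃CoPH F N θ P)` — node N13's product, by name — YIELDS the repaired §2 [III] form of every `ρ_k` of record, `∀ k ≤ K, SLaw₁₃CoPH θ P k`.
[cite: Balaban1988Convergent, Thm 1 p.262 (bookkeeping); p.244] -/
theorem sLaw₁₃CoPH_all_of_b14_main_of_rOpLeaf (hC : w.C = (datumOfRecord₁₃CoPH F N θ h).C) (hV : ROpLeaf (VOfRecord₁₃CoPH F N θ P) → (leavesP w P).rOperation)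
    (hN : Dag.B14_main (leavesP w P))
    (h7 : (leavesP w P).b7) (h8 : (leavesP w P).b8) (h9 : (leavesP w P).b9) (h10 : (leavesP w P).b10) (h11 : (leavesP w P).b11)
    (hsf : (leavesP w P).smallCouplings → (leavesP w P).smallFieldInductive)
    (hfc : (leavesP w P).smallCouplings → (leavesP w P).flowControl)
    (hR : ROpLeaf (VOfRecord₁₃CoPH F N θ P)) (hsc : (leavesP w P).smallCouplings) :
    ∀ k, k ≤ P.K → SLaw₁₃CoPH F N θ P k :=
  (densitiesDescribed_iff_core F N (coreOfRecord₁₃CoPH F N θ) (towerOfRecord₁₃CoPH F N θ h) w P hC).1 (hN h7 h8 h9 h10 h11 hsf hfc (hV hR) hsc)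

/-- **THEOREM 1 [III] AT A STAGE-13-BOUND RUN FROM THE TWO NODES' PRINTED PRODUCTS, the junction BY NAME** (how `Dag.uv_stability_of_series` hands N13's product to
N11, read at the objects of record): at a run bound by `w.up P = upOfRecord₅C F N (θ.toStage5₁₃CoPH F N) P`, GIVEN node N13's statement `Dag.B16_main (leavesP w P)` with
ITS in-edge leaves and `rBasicStep` — which YIELDS the leaf (§1) —, N11's ONE slot (S1ᵀ) at the objects of record and N11's remaining antecedents: under the interval
hypothesis EVERY `ρ_k` of record, `k ≤ K`, has the repaired §2 [III] form of record.  Pure composition; both nodes' analytic contents stay displayed.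
[cite: Balaban1988Convergent, Thm 1 p.262; Theorem p.245; p.244; Balaban1989LargeFieldII, Thm 1 p.355] -/
theorem sLaw₁₃CoPH_all_of_b16_main_of_slots (hup : w.up P = upOfRecord₅C F N (θ.toStage5₁₃CoPH F N) P)
    (hN13 : Dag.B16_main (leavesP w P))
    (h5 : (leavesP w P).b5) (h6 : (leavesP w P).b6) (h7 : (leavesP w P).b7) (h8 : (leavesP w P).b8) (h9 : (leavesP w P).b9)
    (h10 : (leavesP w P).b10) (h11 : (leavesP w P).b11) (h13 : (leavesP w P).b13) (hrb : (leavesP w P).rBasicStep)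
    (hsf : (leavesP w P).smallCouplings → (leavesP w P).smallFieldInductive)
    (hfc : (leavesP w P).smallCouplings → (leavesP w P).flowControl)
    (hT : (leavesP w P).b7 → (leavesP w P).b8 → (leavesP w P).b9 → (leavesP w P).b10 → (leavesP w P).b11 →
      (leavesP w P).smallCouplings → (leavesP w P).smallFieldInductive → (leavesP w P).flowControl →
        ∀ k, k < P.K → SLaw₁₃CoPH F N θ P k → TLaw₁₃CoPH F N θ P k)
    (hsc : (leavesP w P).smallCouplings) : ∀ k, k ≤ P.K → SLaw₁₃CoPH F N θ P k :=
  have hR : ROpLeaf (VOfRecord₁₃CoPH F N θ P) := rOpLeaf₁₃CoPH_of_b16_main F N θ w P hup hN13 h5 h6 h7 h9 h10 h11 h13 hrb hsf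
  sLaw₁₃CoPH_all_of_rAssumedP244 F N θ P ((rOpLeaf₁₃CoPH_iff_rAssumedP244 F N θ P).1 hR) (hT h7 h8 h9 h10 h11 hsc (hsf hsc) (hfc hsc))

/-- **N11 ∧ N13's 𝐑-product AT A STAGE-13-BOUND WORLD, the junction by name**: from N13's node statement (+ its in-edges) and N11's (S1ᵀ), `Dag.B14_main (leavesP w P)`
— this seat's `b14_main_at_record₁₃CoPH_of_rOpLeaf` with the leaf READ from N13's statement (§1). [cite: Balaban1988Convergent, Thm 1 p.262; Theorem p.245; p.244; Balaban1989LargeFieldII, Thm 1 p.355] -/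
theorem b14_main_at_record₁₃CoPH_of_b16_main (hC : w.C = (datumOfRecord₁₃CoPH F N θ h).C) (hup : w.up P = upOfRecord₅C F N (θ.toStage5₁₃CoPH F N) P)
    (hN13 : Dag.B16_main (leavesP w P))
    (h5 : (leavesP w P).b5) (h6 : (leavesP w P).b6) (h13 : (leavesP w P).b13) (hrb : (leavesP w P).rBasicStep)
    (hT : (leavesP w P).b7 → (leavesP w P).b8 → (leavesP w P).b9 → (leavesP w P).b10 → (leavesP w P).b11 →
      (leavesP w P).smallCouplings → (leavesP w P).smallFieldInductive → (leavesP w P).flowControl →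
        ∀ k, k < P.K → SLaw₁₃CoPH F N θ P k → TLaw₁₃CoPH F N θ P k) :
    Dag.B14_main (leavesP w P) := by
  intro h7 h8 h9 h10 h11 hsf hfc _ hsc
  exact (densitiesDescribed_iff_core F N (coreOfRecord₁₃CoPH F N θ) (towerOfRecord₁₃CoPH F N θ h) w P hC).2
    (sLaw₁₃CoPH_all_of_b16_main_of_slots F N θ w P hup hN13 h5 h6 h7 h8 h9 h10 h11 h13 hrb hsf hfc hT hsc)

end Node

/-! ## §5. [V]∕[III] THEOREM 1 AS THE TREE STATES IT (`B16.Thm1Printed` at the Stage-13 datum of record) FROM [III]'s TWO SENTENCES IN [III]'s CURRENCY -/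

section Thm1Printed

variable (Zr : (q : B12.RunParams) → TkResidualW F N (FluctV N) q.K) (Zh : (q : B12.RunParams) → ℕ → (ℕ → Set (Site (F.P q.K) 0)) → (ℕ → Set (Site (F.P q.K) 0)) → TkResidualW F N (FluctV N) q.K)
  (Phih : (q : B12.RunParams) → ℕ → (ℕ → Set (Site (F.P q.K) 0)) → (ℕ → Set (Site (F.P q.K) 0)) → (ℕ → Plaq (F.P q.K) 0 → ℝ)) (θ : Stage13HParams F N) (h : θ.Provisos₁₃CoPH F N)

/-- **`B16.Thm1Printed (datumOfRecord₁₃CoPH F N θ h).C` FROM THE THEOREM OF p. 245 AND THE p. 244 ASSUMPTION AT THE OBJECTS OF RECORD, law currency, `T`-free** (the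
route's (B)-face first conjunct): along every run whose flow stays in a window `]0, γ]` (`0 < γ`), `hT` (N11's product) and `B14.RAssumedP244` at the Stage-13 carriers
of record (`hR`, N13's product AS [III] ASSUMES IT) give Theorem 1 at the datum — node00-def-T's `thm1Printed_datumOfRecord₁₃CoPH_of_tLaw_rOpLeaf` read through §1.
[cite: Balaban1988Convergent, Thm 1 p.262; Theorem p.245; p.244; Balaban1989LargeFieldII, Thm 1 p.355 + p.391] -/
theorem thm1Printed_datumOfRecord₁₃CoPH_of_laws_rAssumedP244 {γ : ℝ} (hγ : 0 < γ)
    (hT : ∀ P : B12.RunParams, ((datumOfRecord₁₃CoPH F N θ h).C P).flow.InInterval γ P.K →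
      ∀ k, k < P.K → SLaw₁₃CoPH F N θ P k → TLaw₁₃CoPH F N θ P k)
    (hR : ∀ P : B12.RunParams, ((datumOfRecord₁₃CoPH F N θ h).C P).flow.InInterval γ P.K →
      B14.RAssumedP244 (VOfRecord₁₃CoPH F N θ P).R (VOfRecord₁₃CoPH F N θ P).Scorr (VOfRecord₁₃CoPH F N θ P).S P.K) :
    B16.Thm1Printed (datumOfRecord₁₃CoPH F N θ h).C :=
  thm1Printed_datumOfRecord₁₃CoPH_of_tLaw_rOpLeaf F N θ h hγ hT (fun P hP => (rOpLeaf₁₃CoPH_iff_rAssumedP244 F N θ P).2 (hR P hP))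

/-- **`B16.Thm1Printed` AT THE STAGE-13 DATUM FROM [III]'s TWO SENTENCES IN [III]'s OWN NAMES** — `B14.ThmP245PrintedI` (the Theorem of p. 245, sequence reading, for
any `T`-family agreeing with the tower on the trajectory of each windowed run) and `B14.RAssumedP244` (p. 244) at the Stage-13 carriers of record: the director's row
«`ThmP245Printed` via `rOperation` from N13's `ROpLeaf`» composed to the (B)-face's first conjunct, by name. [cite: Balaban1988Convergent, Thm 1 p.262; Theorem p.245; p.244; Balaban1989LargeFieldII, Thm 1 p.355] -/
theorem thm1Printed_datumOfRecord₁₃CoPH_of_thmP245I_rAssumedP244 {γ : ℝ} (hγ : 0 < γ)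
    (T : (P : B12.RunParams) → (k : ℕ) → RTOpI (F.P P.K) k (SU N) (avOfRecord F N P.K k))
    (hTT : ∀ (P : B12.RunParams) (k : ℕ), k < P.K → (T P k).T (densOfRecord₁₃ F N θ.toStage13Params P k) = tdensOfRecord₁₃ F N θ.toStage13Params P k)
    (hT : ∀ P : B12.RunParams, ((datumOfRecord₁₃CoPH F N θ h).C P).flow.InInterval γ P.K →
      B14.ThmP245PrintedI (T P) (densOfRecord₁₃ F N θ.toStage13Params P) (VOfRecord₁₃CoPH F N θ P).S (VOfRecord₁₃CoPH F N θ P).Scorr P.K)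
    (hR : ∀ P : B12.RunParams, ((datumOfRecord₁₃CoPH F N θ h).C P).flow.InInterval γ P.K →
      B14.RAssumedP244 (VOfRecord₁₃CoPH F N θ P).R (VOfRecord₁₃CoPH F N θ P).Scorr (VOfRecord₁₃CoPH F N θ P).S P.K) :
    B16.Thm1Printed (datumOfRecord₁₃CoPH F N θ h).C :=
  thm1Printed_datumOfRecord₁₃CoPH_of_laws_rAssumedP244 F N θ h hγ
    (fun P hP => (thmP245PrintedI_at_record₁₃CoPH_iff_laws F N θ P (T P) (hTT P)).1 (hT P hP)) hR

/-- **★ THE DIRECTOR's ROW LITERALLY, ON THE LIVE-SELECTOR LINE: `B16.Thm1Printed` AT THE STAGE-13 DATUM FROM [III]'s THEOREM OF p. 245 IN [III]'s OWN NAME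
(`B14.ThmP245PrintedI`) «via `rOperation` from N13's `ROpLeaf`» WITH THE `ROpLeaf` SUPPLIED** — at a `θ` carrying node00-def-T's live-selector clause `hsel` the leaf
is this seat's theorem `…B16RLeafRecord13LiveCoPH.rOpLeaf_VOfRecord₁₃CoPH_of_liveSel_of_rstep` (from `Provisos₁₃CoPH`'s row `rstep`, admissibility and the displayed
term-constant signs), so the (B)-face's first conjunct rests on the Theorem of p. 245 ALONE. [cite: Balaban1988Convergent, Theorem p.245, Thm 1 p.262, p.244; Balaban1989LargeFieldII, Thm 1 p.355; Balaban1989LargeFieldI, (0.3) p.176, p.177 (i)–(ii)] -/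
theorem thm1Printed_datumOfRecord₁₃CoPH_of_thmP245I_of_liveSel (hθ : θ.Admissible F N) (hκ : 0 ≤ θ.s2.lf.κ) (hE₀ : 0 ≤ θ.s2.lf.E₀) (hB₀ : 0 ≤ θ.s2.lf.B₀)
    (hsel : θ.ppSel = ppSelLiveOfRecord F N θ.ν θ.τ9 (EOfRecord₁₃ F N θ.toStage13Params) (wOfRecord₉ F N θ.toStage9Params)) {γ : ℝ} (hγ : 0 < γ)
    (T : (P : B12.RunParams) → (k : ℕ) → RTOpI (F.P P.K) k (SU N) (avOfRecord F N P.K k))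
    (hTT : ∀ (P : B12.RunParams) (k : ℕ), k < P.K → (T P k).T (densOfRecord₁₃ F N θ.toStage13Params P k) = tdensOfRecord₁₃ F N θ.toStage13Params P k)
    (hT : ∀ P : B12.RunParams, ((datumOfRecord₁₃CoPH F N θ h).C P).flow.InInterval γ P.K →
      B14.ThmP245PrintedI (T P) (densOfRecord₁₃ F N θ.toStage13Params P) (VOfRecord₁₃CoPH F N θ P).S (VOfRecord₁₃CoPH F N θ P).Scorr P.K) :
    B16.Thm1Printed (datumOfRecord₁₃CoPH F N θ h).C :=
  thm1Printed_datumOfRecord₁₃CoPH_of_thmP245I_rAssumedP244 F N θ h hγ T hTT hT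
    (fun P _ => (rOpLeaf₁₃CoPH_iff_rAssumedP244 F N θ P).1
      (rOpLeaf_VOfRecord₁₃CoPH_of_liveSel_of_rstep F N θ P (fun p k _ hk => h.rstep p k hk) hθ hκ hE₀ hB₀ hsel))

/-- **★★ THE ROW AT THE K0‴ WITNESS OF RECORD: `B16.Thm1Printed (datumOfRecord₁₃CoPH F N θ₁₃ h).C`, `θ₁₃ = theta13LiveOfRecord F N`, FROM [III]'s
THEOREM OF p. 245 IN ITS OWN NAME (`B14.ThmP245PrintedI`, any `T`-family agreeing with the tower on the trajectory) along the windowed runs — NOTHING ELSE**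
(the `ROpLeaf` is this seat's CLOSED theorem `…B16RLeafRecord13LiveCoPH.rOpLeaf_VOfRecord₁₃CoPH_theta13LiveOfRecord` — zero hypotheses; `hrec : Provisos₁₃CoPH` is only
the datum's key, displayed).
[cite: Balaban1988Convergent, Theorem p.245, Thm 1 p.262, p.244; Balaban1989LargeFieldII, Thm 1 p.355; Balaban1989LargeFieldI, (0.3) p.176, p.177 (i)–(ii)] -/
theorem thm1Printed_datumOfRecord₁₃CoPH_theta13LiveOfRecord_of_thmP245I (hrec : (⟨⟨theta13LiveOfRecord F N, Zr⟩, Zh, Phih⟩ : Stage13HParams F N).Provisos₁₃CoPH F N) {γ : ℝ} (hγ : 0 < γ)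
    (T : (P : B12.RunParams) → (k : ℕ) → RTOpI (F.P P.K) k (SU N) (avOfRecord F N P.K k))
    (hTT : ∀ (P : B12.RunParams) (k : ℕ), k < P.K →
      (T P k).T (densOfRecord₁₃ F N (theta13LiveOfRecord F N) P k) = tdensOfRecord₁₃ F N (theta13LiveOfRecord F N) P k)
    (hT : ∀ P : B12.RunParams, ((datumOfRecord₁₃CoPH F N (⟨⟨theta13LiveOfRecord F N, Zr⟩, Zh, Phih⟩ : Stage13HParams F N) hrec).C P).flow.InInterval γ P.K →
      B14.ThmP245PrintedI (T P) (densOfRecord₁₃ F N (theta13LiveOfRecord F N) P) (VOfRecord₁₃CoPH F N (⟨⟨theta13LiveOfRecord F N, Zr⟩, Zh, Phih⟩ : Stage13HParams F N) P).S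
        (VOfRecord₁₃CoPH F N (⟨⟨theta13LiveOfRecord F N, Zr⟩, Zh, Phih⟩ : Stage13HParams F N) P).Scorr P.K) :
    B16.Thm1Printed (datumOfRecord₁₃CoPH F N (⟨⟨theta13LiveOfRecord F N, Zr⟩, Zh, Phih⟩ : Stage13HParams F N) hrec).C :=
  thm1Printed_datumOfRecord₁₃CoPH_of_thmP245I_rAssumedP244 F N (⟨⟨theta13LiveOfRecord F N, Zr⟩, Zh, Phih⟩ : Stage13HParams F N) hrec hγ T hTT hT
    (fun P _ => (rOpLeaf₁₃CoPH_iff_rAssumedP244 F N (⟨⟨theta13LiveOfRecord F N, Zr⟩, Zh, Phih⟩ : Stage13HParams F N) P).1 (rOpLeaf_VOfRecord₁₃CoPH_theta13LiveOfRecord F N Zr Zh Phih P))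

/-- **The director's row at the v1.7 SEPARATED-RANGE DATUM `datumOfRecord₁₃SepCoPH F N θ h` (`h : Provisos₁₃SepCoPH`, the K1-class key; `= datumOfRecord₁₃CoPH θ h.toCore` by
`rfl`, node00-def-T `datumOfRecord₁₃SepCoPH_eq_coPH`)**: `B16.Thm1Printed` at the live selector from [III]'s Theorem of p. 245 in its own name, the `ROpLeaf` supplied.
[cite: Balaban1988Convergent, Theorem p.245, Thm 1 p.262, p.244; Balaban1989LargeFieldII, Thm 1 p.355; Balaban1989LargeFieldI, (0.3) p.176, p.177 (i)–(ii)] -/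
theorem thm1Printed_datumOfRecord₁₃SepCoPH_of_thmP245I_of_liveSel (h : θ.Provisos₁₃SepCoPH F N) (hθ : θ.Admissible F N) (hκ : 0 ≤ θ.s2.lf.κ)
    (hE₀ : 0 ≤ θ.s2.lf.E₀) (hB₀ : 0 ≤ θ.s2.lf.B₀)
    (hsel : θ.ppSel = ppSelLiveOfRecord F N θ.ν θ.τ9 (EOfRecord₁₃ F N θ.toStage13Params) (wOfRecord₉ F N θ.toStage9Params)) {γ : ℝ} (hγ : 0 < γ)
    (T : (P : B12.RunParams) → (k : ℕ) → RTOpI (F.P P.K) k (SU N) (avOfRecord F N P.K k))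
    (hTT : ∀ (P : B12.RunParams) (k : ℕ), k < P.K → (T P k).T (densOfRecord₁₃ F N θ.toStage13Params P k) = tdensOfRecord₁₃ F N θ.toStage13Params P k)
    (hT : ∀ P : B12.RunParams, ((datumOfRecord₁₃SepCoPH F N θ h).C P).flow.InInterval γ P.K →
      B14.ThmP245PrintedI (T P) (densOfRecord₁₃ F N θ.toStage13Params P) (VOfRecord₁₃CoPH F N θ P).S (VOfRecord₁₃CoPH F N θ P).Scorr P.K) :
    B16.Thm1Printed (datumOfRecord₁₃SepCoPH F N θ h).C :=
  thm1Printed_datumOfRecord₁₃CoPH_of_thmP245I_of_liveSel F N θ h.toCore hθ hκ hE₀ hB₀ hsel hγ T hTT hT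

end Thm1Printed

end Literature.MathematicalPhysics.QuantumFieldTheory.Balaban1983to89.B14NodeKnitRecord13RCoPH

end
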